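import Summits.QuantumFields.BalabanUV.T4Continuum.Support.NE3HessBounds
import Summits.QuantumFields.BalabanUV.T4Continuum.Support.AveragingDeficitPeriodicCounting

/-!
# T⁴ programme, node NE3 — THE SHARED TYPED BINDERS OF THE ENERGY ROADS: `TangentCoercive` (tangent coercivity of
# the Wilson Hessian, = the cell-supplied lemma ML at statement level) with its REDUCTION to a Poincaré–Hodge
# inequality on the tangent space, and `RelRep` (the relative representative of a competitor over a BACKGROUND
# given as a parameter — B11 (19)–(21) TYPE, no Landau operator typed)

First generation of the NE3 prover lineage P3 of the cell `pub-balaban` (unit `b2b-balaban-t4-ne3-p3`; co-owner #3 of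
`BINDER-OWNERS.md` row NE3), fourth file of the `Support/NE3Hess*` family; typing AGREED with road P2 (CLAIMS.log
l.5380 «`LandauRep` … WITH THE BACKGROUND AS A PARAMETER … + `TangentCoercive` (L5 statement-level)», reply l.≈5550,
their l.≈5812 «in YOUR `Support/NE3HessShapes.lean` — AGREED»).  Road P2 (`t4/skeletons/NE3-t4-ne3-p2.md`) instantiates
its `RouteLeaves.coer`∕`rep` from these BY NAME; road P3 (`t4/skeletons/NE3-t4-ne3-p3.md`) uses them in (E2)∕L1.

WHAT IS TYPED ∕ PROVED ([folklore]; NOTHING is asserted for Bałaban's minimisers — the two `Prop`-valued shapes are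
HYPOTHESIS SHAPES, inhabited here only trivially):
§1 `plaqsOf N` (the plaquettes based in a site set) with `sum_plaqsOf` and `curlSq_eq_sum_plaqsOf`
   (`curlSq V ψ N = Σ_{p ∈ plaqsOf N} ‖curl V ψ p‖²`), so that this family's `hess V X Y (plaqsOf N)` and road P2's
   `energyNorm W Z N = √(curlSq W Z N + dirSq Z N)` (`NE3EnergyShapes`, p206860) live on the same window; and the
   torus bond count `sum_plaqsOf_bondSq_le` (`Σ_{p∈plaqsOf(periodBox M)} bondSq Z p ≤ 4d·dirSq Z (periodBox M)` for
   `M`-periodic `Z`);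
§2 `TangentCoercive U T N c : Prop := ∀ Z ∈ T, c·(curlSq U Z N + dirSq Z N) ≤ hess U Z Z (plaqsOf N)` — tangent
   coercivity of the Wilson Hessian at the background `U` on a set `T` of directions (dictionary: `T` = the
   constraint-and-Landau tangent space at `U`; `c = c_T` of ML-SUPPLIED; `= c·energyNorm² ≤ hess`), `mono` lemmas,
   and **`tangentCoercive_of_poincare`**: for unitary `U` in `SmallField U a` with `a ≥ 0`, a POINCARÉ–HODGE bound
   on `T` (`dirSq Z N ≤ C_P·curlSq U Z N`, `C_P ≥ 0`) and a bond-multiplicity bound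
   (`Σ_{p∈plaqsOf N} bondSq Z p ≤ C_b·dirSq Z N`), under the displayed smallness `7a·C_b·C_P ≤ 1∕N`, give
   `TangentCoercive U T N ((1∕N − 7a·C_b·C_P)∕(1 + C_P))` — by
   `NE3HessBounds.hess_self_ge`; i.e. what REMAINS of leaf L5 for both roads is exactly the Poincaré–Hodge inequality
   on the tangent space (the cell's G-ne3p2-9 core: flat torus = tree `B6Cov2156Torus.lowerOnConstrainedT_of_represents`,
   non-flat by patching or [Balaban1985BackgroundPropagators] Thm 3.12 TYPE) plus elementary bond counting;
§3 `RelRep U W P ε` — a competitor `W` represented over the BACKGROUND `U` (a parameter): a unitary `P`-periodic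
   gauge transformation `u` and a skew `P`-periodic direction `X` with `gaugeAct u W = vary U X 1` and the sup
   smallness `‖X(b)‖ ≤ ε`, `‖(d_U X)(p)‖ ≤ ε` (B11 (19) TYPE at unit scale, [Balaban1985Variational] Prop. 2 p. 281;
   the Landau condition (21) is NOT a field — roads add `X ∈ T` for their own `T`); `RelRep.flat` (non-vacuity:
   `W = U` with `u = 1`, `X = 0`).

CURRENCY CAVEAT (courier note added at filing by `b2b-balaban-t4-ne3-formalise-leaf-02` gen 2, on the located objection
GAPS.md § G-ne7king10-1 of 2026-08-20T08:53Z; documentation only — every declaration below is the author's, unchanged).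
`TangentCoercive U T N c` weighs `dirSq` with weight `1` (road P2's UNWEIGHTED `NE3EnergyShapes.energyNorm`).  On the
FLAT background with `T ⊇` the k-fold constrained Landau tangent space of the level-`k` torus, band-limited
divergence-free witnesses give `hess ≤ curlSq ≤ 4d·sin²(π/L^k)·dirSq`, so any such `c` satisfies `c ≤ 4d·sin²(π/L^k)`:
NO k-UNIFORM constant exists in this currency, and `tangentCoercive_of_poincare` then needs `C_P ≳ L^{2k}/(4dπ²)`,
i.e. delivers `c ≍ L^{−2k}`.  The shape and the reduction below are TRUE as stated (per level); what must NOT be done is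
to instantiate a k-free `c` (e.g. the `{c}` of `NE3EnergyAssembly.ne3EnergyRate_of_routeLeaves`) through them on such a
`T`.  The k-uniform form of ML lives in the WEIGHTED norm `curlSq + dirSq/(L^k)²` (ML-SUPPLIED's `N(W)`, the tree's
`B11HessianL2` docstring norm); its typing (`energyNormW` ∕ a weighted twin of `TangentCoercive`) is left to the single
writers of roads P2∕P3 (typer ρ19).  Nothing in this caveat is a theorem of this file.

HONEST FRAMING.  Finite-T⁴ ultraviolet bookkeeping (rung (B)+1); typed binders + one elementary reduction; no
conditional of the cell (`BetaPertH`, (B), (B^μ)); NOT infinite volume, NOT a mass gap, NOT Clay, NOT summit progress.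
ABSOLUTE RULE kept: no printed sentence is a hypothesis of a theorem; `TangentCoercive`∕`RelRep` are shapes over the
tree's objects, asserted for no minimiser.  PLACEMENT: `Summits/QuantumFields/BalabanUV/`; imports this unit's
`Support.NE3HessBounds` and row NE3-R2's `Support.AveragingDeficitPeriodicCounting` (for `IsPeriodicDir`); moves nothing.
-/

set_option autoImplicit false

open scoped BigOperators Matrix Matrix.Norms.L2Operator
open NormedSpace Finset

namespace Summit.QuantumFields.BalabanUV.T4Continuum.NE3HessShapes

open Literature.MathematicalPhysics.QuantumFieldTheory.Balaban1983to89
open B7Prop1Explicit B7Prop2Explicit MatrixLog UnitaryModel MatrixNorms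
open T4AveragingDeficitWall hiding Site Plane Plaq Bond
open AveragingDeficitPeriodicCounting (IsPeriodicDir)
open T4AveragingDeficitWallBoundary (periodBox sum_periodBox_shift)
open NE3HessForm NE3HessBounds

noncomputable section

variable {d : ℕ} {n : Type*} [Fintype n] [DecidableEq n]

/-! ## §1 The plaquette window of a site set -/

/-- The plaquettes based in the site set `N`: `N × (all planes)`. [folklore] -/
def plaqsOf (N : Finset (Site d)) : Finset (T4AveragingDeficitWall.Plaq d) := N ×ˢ (Finset.univ : Finset (T4AveragingDeficitWall.Plane d))

omit [Fintype n] [DecidableEq n] in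
/-- Sums over `plaqsOf N` are iterated sums over sites and planes. [folklore] -/
theorem sum_plaqsOf (N : Finset (Site d)) (f : T4AveragingDeficitWall.Plaq d → ℝ) :
    ∑ p ∈ plaqsOf N, f p = ∑ z ∈ N, ∑ π : T4AveragingDeficitWall.Plane d, f (z, π) := by
  unfold plaqsOf
  rw [Finset.sum_product]

/-- `curlSq V ψ N = Σ_{p ∈ plaqsOf N} ‖(d_V ψ)(p)‖²`. [folklore] -/
theorem curlSq_eq_sum_plaqsOf (V : Site d → Fin d → (Matrix n n ℂ)ˣ) (ψ : Site d → Fin d → Matrix n n ℂ) (N : Finset (Site d)) :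
    curlSq V ψ N = ∑ p ∈ plaqsOf N, ‖curl V ψ p‖ ^ 2 := by
  rw [sum_plaqsOf]; rfl

/-- **BOND MULTIPLICITY ON THE TORUS**: for an `M`-periodic direction (`M ≥ 1`),
`Σ_{p ∈ plaqsOf (periodBox M)} bondSq Z p ≤ 4d · dirSq Z (periodBox M)` (every bond lies in at most `2(d−1)` plaquettes;
the cruder constant `4d` by over-counting planes as ordered pairs; periodic shift by `sum_periodBox_shift`). This is
the hypothesis `hb` of `tangentCoercive_of_poincare` below on the torus window, `C_b = 4d`. [folklore] -/
theorem sum_plaqsOf_bondSq_le {M : ℕ} (hM : 1 ≤ M) {Z : Site d → Fin d → Matrix n n ℂ} (hZ : IsPeriodicDir Z M) :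
    ∑ p ∈ plaqsOf (periodBox M), bondSq Z p ≤ 4 * d * dirSq Z (periodBox M) := by
  rw [sum_plaqsOf]
  -- periodic shifts of the single-direction sums
  have hshift : ∀ (μ ν : Fin d), ∑ z ∈ periodBox M, ‖Z (z + e μ) ν‖ ^ 2 = ∑ z ∈ periodBox M, ‖Z z ν‖ ^ 2 :=
    fun μ ν => sum_periodBox_shift M hM (g := fun x => ‖Z x ν‖ ^ 2) (fun x κ => by simp only [hZ x κ ν]) (e μ)
  -- per-direction sums
  set S : Fin d → ℝ := fun κ => ∑ z ∈ periodBox M, ‖Z z κ‖ ^ 2 with hS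
  have hS0 : ∀ κ, 0 ≤ S κ := fun κ => by rw [hS]; positivity
  have hdir : dirSq Z (periodBox M) = ∑ κ : Fin d, S κ := by
    unfold dirSq; rw [Finset.sum_comm]
  -- rewrite the plaquette sum as a sum over planes of 2 S μ + 2 S ν
  have hplane : ∑ z ∈ periodBox M, ∑ π : T4AveragingDeficitWall.Plane d, bondSq Z (z, π)
      = ∑ π : T4AveragingDeficitWall.Plane d, (2 * S π.1.1 + 2 * S π.1.2) := by
    rw [Finset.sum_comm]
    refine Finset.sum_congr rfl fun π _ => ?_
    simp only [bondSq, bondSqAt, Finset.sum_add_distrib, hshift, hS]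
    ring
  rw [hplane]
  -- over-count planes by ordered pairs
  have hsub : ∑ π : T4AveragingDeficitWall.Plane d, (2 * S π.1.1 + 2 * S π.1.2)
      ≤ ∑ q : Fin d × Fin d, (2 * S q.1 + 2 * S q.2) := by
    have hset : ∀ q : Fin d × Fin d,
        q ∈ (Finset.univ : Finset (Fin d × Fin d)).filter (fun q => q.1 < q.2) ↔ q.1 < q.2 := fun q => by simp
    rw [← Finset.sum_subtype ((Finset.univ : Finset (Fin d × Fin d)).filter (fun q => q.1 < q.2)) hset
      (fun q : Fin d × Fin d => 2 * S q.1 + 2 * S q.2)]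
    exact Finset.sum_le_sum_of_subset_of_nonneg (Finset.filter_subset _ _)
      (fun q _ _ => by have := hS0 q.1; have := hS0 q.2; positivity)
  have hpair : ∑ q : Fin d × Fin d, (2 * S q.1 + 2 * S q.2) = 4 * d * ∑ κ : Fin d, S κ := by
    rw [Fintype.sum_prod_type]
    simp only [Finset.sum_add_distrib, Finset.sum_const, Finset.card_univ, Fintype.card_fin, nsmul_eq_mul,
      ← Finset.mul_sum]
    ring
  rw [hdir]
  linarith

/-! ## §2 Tangent coercivity and its reduction to a Poincaré–Hodge inequality on the tangent space -/

/-- **TANGENT COERCIVITY** (hypothesis SHAPE; = the cell-supplied lemma ML at statement level, unit scale):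
`∀ Z ∈ T, c·(curlSq U Z N + dirSq Z N) ≤ hess U Z Z (plaqsOf N)`, i.e. `c·energyNorm U Z N² ≤ Hess_U[Z, Z]` with road
P2's `energyNorm` (`NE3EnergyShapes`).  Dictionary (context only, nothing printed is asserted): `T` = the
constraint-and-Landau tangent space at `U` of B11 (83) p. 290 «QδA′ = 0, RD*δA′ = 0»; `c = c_T(d, L, n)` of the cell's
ML-SUPPLIED.  Asserted for no `U` here.  CURRENCY CAVEAT (module docstring, G-ne7king10-1): in this UNWEIGHTED norm no
k-uniform `c > 0` exists on `T ⊇` the constrained Landau tangent space (`c ≤ 4d·sin²(π/L^k)`); k-uniform ML needs the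
weighted norm `curlSq + dirSq/(L^k)²`. [folklore] -/
def TangentCoercive (U : Site d → Fin d → (Matrix n n ℂ)ˣ) (T : Set (Site d → Fin d → Matrix n n ℂ)) (N : Finset (Site d)) (c : ℝ) : Prop :=
  ∀ Z ∈ T, c * (curlSq U Z N + dirSq Z N) ≤ hess U Z Z (plaqsOf N)

/-- Monotonicity in the constant. [folklore] -/
theorem TangentCoercive.mono {U : Site d → Fin d → (Matrix n n ℂ)ˣ} {T : Set (Site d → Fin d → Matrix n n ℂ)} {N : Finset (Site d)}
    {c c' : ℝ} (h : TangentCoercive U T N c) (hc : c' ≤ c) : TangentCoercive U T N c' := by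
  intro Z hZ
  have h0 : 0 ≤ curlSq U Z N + dirSq Z N := by unfold curlSq dirSq; positivity
  exact (mul_le_mul_of_nonneg_right hc h0).trans (h Z hZ)

/-- Monotonicity in the set of directions. [folklore] -/
theorem TangentCoercive.anti {U : Site d → Fin d → (Matrix n n ℂ)ˣ} {T T' : Set (Site d → Fin d → Matrix n n ℂ)} {N : Finset (Site d)}
    {c : ℝ} (h : TangentCoercive U T N c) (hT : T' ⊆ T) : TangentCoercive U T' N c :=
  fun Z hZ => h Z (hT hZ)

/-- The trivial instance: every `T` is `0`-coercive wherever the Hessian is non-negative on `T`. [folklore] -/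
theorem tangentCoercive_zero_of_nonneg {U : Site d → Fin d → (Matrix n n ℂ)ˣ} {T : Set (Site d → Fin d → Matrix n n ℂ)} {N : Finset (Site d)}
    (h : ∀ Z ∈ T, 0 ≤ hess U Z Z (plaqsOf N)) : TangentCoercive U T N 0 := by
  intro Z hZ; simpa using h Z hZ

/-- **REDUCTION OF TANGENT COERCIVITY TO A POINCARÉ–HODGE INEQUALITY ON `T`.**  For unitary `U` in `SmallField U a`
(`0 ≤ a`), skew directions, a Poincaré–Hodge bound `dirSq Z N ≤ C_P·curlSq U Z N` on `T` and the bond-multiplicity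
bound `Σ_{p ∈ plaqsOf N} bondSq Z p ≤ C_b·dirSq Z N` on `T` (`C_P, C_b ≥ 0`), the Hessian is tangent-coercive with
`c = (1∕N − 7a·C_b·C_P)∕(1 + C_P)` under the DISPLAYED smallness `7a·C_b·C_P ≤ 1∕N` of the plaquette radius.
Proof: `NE3HessBounds.hess_self_ge` + the two hypotheses.  What remains of ML for both roads is therefore
the Poincaré–Hodge inequality on the constraint-and-Landau tangent space.  CURRENCY CAVEAT (module docstring,
G-ne7king10-1): on the level-`k` torus in lattice units the constrained Poincaré constant is `C_P ≍ L^{2k}`, so the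
constant delivered here is `≍ L^{−2k}`, NOT k-uniform; the k-uniform statement belongs to the weighted norm. [folklore] -/
theorem tangentCoercive_of_poincare [Nonempty n] {U : Site d → Fin d → (Matrix n n ℂ)ˣ} (hU : IsUnitaryCfg U) {a : ℝ} (ha : 0 ≤ a)
    (hUa : SmallField U a) {T : Set (Site d → Fin d → Matrix n n ℂ)} (hskew : ∀ Z ∈ T, IsSkewDir Z) {N : Finset (Site d)}
    {CP Cb : ℝ} (hCP : 0 ≤ CP) (hCb : 0 ≤ Cb)
    (hsmall : 7 * a * Cb * CP ≤ 1 / (Fintype.card n : ℝ))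
    (hP : ∀ Z ∈ T, dirSq Z N ≤ CP * curlSq U Z N)
    (hb : ∀ Z ∈ T, ∑ p ∈ plaqsOf N, bondSq Z p ≤ Cb * dirSq Z N) :
    TangentCoercive U T N ((1 / (Fintype.card n : ℝ) - 7 * a * Cb * CP) / (1 + CP)) := by
  intro Z hZ
  have hge := hess_self_ge hU (hskew Z hZ) hUa (plaqsOf N)
  rw [← curlSq_eq_sum_plaqsOf] at hge
  have hPZ := hP Z hZ
  have hbZ := hb Z hZ
  -- hess ≥ curlSq/N − 7a·Cb·CP·curlSq
  have h7 : 7 * a * ∑ p ∈ plaqsOf N, bondSq Z p ≤ 7 * a * Cb * CP * curlSq U Z N := by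
    have h := hbZ.trans (mul_le_mul_of_nonneg_left hPZ hCb)
    have := mul_le_mul_of_nonneg_left h (by positivity : (0:ℝ) ≤ 7 * a)
    linarith
  have h1 : curlSq U Z N / (Fintype.card n : ℝ) - 7 * a * Cb * CP * curlSq U Z N ≤ hess U Z Z (plaqsOf N) := by
    linarith
  -- curlSq + dirSq ≤ (1 + CP)·curlSq
  have h2 : curlSq U Z N + dirSq Z N ≤ (1 + CP) * curlSq U Z N := by nlinarith
  have h1P : 0 < 1 + CP := by linarith
  have hsign : 0 ≤ 1 / (Fintype.card n : ℝ) - 7 * a * Cb * CP := by linarith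
  rw [div_mul_eq_mul_div, div_le_iff₀ h1P]
  calc (1 / (Fintype.card n : ℝ) - 7 * a * Cb * CP) * (curlSq U Z N + dirSq Z N)
      ≤ (1 / (Fintype.card n : ℝ) - 7 * a * Cb * CP) * ((1 + CP) * curlSq U Z N) :=
        mul_le_mul_of_nonneg_left h2 hsign
    _ = (curlSq U Z N / (Fintype.card n : ℝ) - 7 * a * Cb * CP * curlSq U Z N) * (1 + CP) := by ring
    _ ≤ hess U Z Z (plaqsOf N) * (1 + CP) := mul_le_mul_of_nonneg_right h1 h1P.le

/-! ## §3 The relative representative of a competitor over a background (B11 (19) TYPE, background a parameter) -/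

/-- **RELATIVE REPRESENTATIVE** (hypothesis∕data SHAPE, background `U` a parameter): a competitor `W` is represented over
`U` by a unitary `P`-periodic gauge transformation `u` and a skew `P`-periodic direction `X` with `W^u = U·e^{X}`
bondwise (`gaugeAct u W = vary U X 1`) and sup smallness of `X` and of its dressed curl.  Dictionary:
[Balaban1985Variational] Prop. 2 p. 281 with (19) «U₁ = e^{iηA}, |A| < ε₂(Lʲη)⁻¹, |∇^η_{U₀}A| < ε₂(Lʲη)⁻²» at unit
scale, background `U₀ := U` (context only, nothing printed is asserted); the Landau condition (21) is NOT a field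
(each road adds `X ∈ T` for its own tangent set).  Asserted for no pair of minimisers here. [folklore] -/
structure RelRep (U W : Site d → Fin d → (Matrix n n ℂ)ˣ) (P : ℤ) (ε : ℝ) where
  /-- the gauge transformation -/
  u : Site d → (Matrix n n ℂ)ˣ
  /-- the relative direction field -/
  X : Site d → Fin d → Matrix n n ℂ
  /-- `u` is `U(N)`-valued -/
  unitary_u : ∀ x, u x ∈ unitaryUnits (Matrix n n ℂ)
  /-- `u` is `P`-periodic -/
  periodic_u : ∀ (x : Site d) (i : Fin d), u (x + P • e i) = u x
  /-- `X` is skew (`𝔲(N)`-valued) -/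
  skew : IsSkewDir X
  /-- `X` is `P`-periodic -/
  periodic_X : IsPeriodicDir X P
  /-- the representation `W^u = U · exp X` bondwise -/
  rep : gaugeAct u W = vary U X 1
  /-- sup smallness of the direction -/
  small : ∀ (x : Site d) (κ : Fin d), ‖X x κ‖ ≤ ε
  /-- sup smallness of the dressed curl -/
  smallCurl : ∀ p : T4AveragingDeficitWall.Plaq d, ‖curl U X p‖ ≤ ε

/-- Non-vacuity: `W = U` is represented over `U` by `u = 1`, `X = 0`, for every `ε ≥ 0`. [folklore] -/
def RelRep.flat (U : Site d → Fin d → (Matrix n n ℂ)ˣ) (P : ℤ) {ε : ℝ} (hε : 0 ≤ ε) : RelRep U U P ε where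
  u := fun _ => 1
  X := fun _ _ => 0
  unitary_u := fun _ => (unitaryUnits (Matrix n n ℂ)).one_mem
  periodic_u := fun _ _ => rfl
  skew := fun _ _ => (skewAdjoint (Matrix n n ℂ)).zero_mem
  periodic_X := fun _ _ _ => rfl
  rep := by
    funext x μ
    simp [gaugeAct, vary]
  small := fun _ _ => by simpa using hε
  smallCurl := fun p => by
    have : curl U (fun _ _ => (0 : Matrix n n ℂ)) p = 0 := by simp [curl, T4AveragingDeficitWall.curlAt, Ad]
    rw [this, norm_zero]; exact hε

/-- From a `RelRep` the bond-ℓ² size on any window: `Σ_{p∈W} bondSq X p ≤ 4·#W·ε²`. [folklore] -/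
theorem RelRep.sum_bondSq_le {U W : Site d → Fin d → (Matrix n n ℂ)ˣ} {P : ℤ} {ε : ℝ} (r : RelRep U W P ε)
    (Wd : Finset (T4AveragingDeficitWall.Plaq d)) : ∑ p ∈ Wd, bondSq r.X p ≤ 4 * Wd.card * ε ^ 2 := by
  have hε : ∀ x κ, ‖r.X x κ‖ ^ 2 ≤ ε ^ 2 := fun x κ =>
    pow_le_pow_left₀ (norm_nonneg _) (r.small x κ) 2
  calc ∑ p ∈ Wd, bondSq r.X p ≤ ∑ _p ∈ Wd, 4 * ε ^ 2 := by
        refine Finset.sum_le_sum fun p _ => ?_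
        unfold bondSq bondSqAt
        linarith [hε p.1 p.2.1.1, hε (p.1 + e p.2.1.1) p.2.1.2, hε (p.1 + e p.2.1.2) p.2.1.1, hε p.1 p.2.1.2]
    _ = 4 * Wd.card * ε ^ 2 := by simp [Finset.sum_const, nsmul_eq_mul]; ring

end

end Summit.QuantumFields.BalabanUV.T4Continuum.NE3HessShapes
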